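import Summits.NavierStokesRegularity.NavierStokesRegularity.Theorems.TypeICertificateLadderTargetStrainCubeSharpDepletion
import Summits.NavierStokesRegularity.NavierStokesRegularity.Theorems.OddMorawetzOrderThreeIndefiniteValue
import Literature.Analysis.FluidPDE.ConstantinDirectionDissipationCalculus
import HarnessLib

/-!
# Crux `Target` = `TypeICertificateLadder.NoTypeIBlowup` (stmt-NavierStokesRegularity-1217), line
# `depletion-ladder`: TOOLS FOR THE CEILING THEOREM — explicit polynomial-Gaussian test fields are admissible

`--supports stmt-NavierStokesRegularity-1217` (tools of the sequel `…StrainCubeCeiling.lean`, DIRECTOR-NS #45 (b)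
«make the CEILING a theorem»). To bound the sharp constant of the depletion inequality
`|∫⟪ω, Dv ω⟫| ≤ κ · sup|v| · ‖ω‖₂ · ‖∇ω‖₂` (`…StrainCubeSharpDepletion`, `κ = (2+√3)/9`) from BELOW one
feeds it explicit fields `v = P(x) e^{-|x|²}` in the tree's polynomial-Gaussian vocabulary
(`OddMorawetzDefs`: `pgv`, `curlP`, `dg`, `polyE`). This file proves, once and for all `P`:

* `lintegral_iteratedFDeriv_sq_lt_top_of_schwartz`, `exists_norm_fderiv_le_of_schwartz`,
  `pgv_admissible` — Schwartz fields (in particular every `P e^{-|x|²}`) satisfy the standing hypotheses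
  of `abs_integral_stretching_le_strainCube_sharp` (`C^∞`, bounded gradient, `D⁰v, D¹v, D²v ∈ L²`);
* `stretching_density_pgv`, `curl_normSq_pgv`, `frobeniusNormSq_fderiv_curl_pgv` — the three densities
  `⟪ω, Dv ω⟫`, `‖ω‖²`, `|∇ω|²_F` of `v = P e^{-|x|²}` are the polynomial Gaussians
  `(Σᵢⱼ cᵢcⱼDⱼPᵢ) e^{-3|x|²}`, `(Σᵢ cᵢ²) e^{-2|x|²}`, `(Σⱼᵢ (Dⱼcᵢ)²) e^{-2|x|²}` (`c = curlP 1 P`,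
  `Dⱼ = ∂ⱼ − 2xⱼ`);
* `integral_monomial_gauss_two_even`, `integral_monomial_gauss_three_even`, `integral_pg_two_of_polyE`,
  `integral_pg_three_of_polyE` — exact Gaussian moments at rates `2` and `3` and the list bookkeeping
  that turns an even monomial expansion into an explicit number;
* `exp_ge_taylor_four` — `1 + t + t²/2 + t³/6 + t⁴/24 ≤ eᵗ` (`t ≥ 0`), for sup bounds of witnesses.

Pure bookkeeping over Mathlib (`SchwartzMap.one_add_le_sup_seminorm_apply`, `integrable_one_add_norm`,
`Real.sum_le_exp_of_nonneg`) and the tree (`curl_pgv`, `fderiv_pgv_apply`, `integral_monomial_gauss`,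
`integral_polyE_mul`, `frobeniusNormSq_eq_sum_sq_coord`). WHAT THIS IS NOT: no statement about
Navier–Stokes; no witness yet (sequel). [folklore]
-/

noncomputable section

open Set Filter Topology MeasureTheory SchwartzMap MvPolynomial Finset Matrix
open scoped RealInnerProductSpace ENNReal NNReal ContDiff
open Literature.Analysis.FluidPDE

namespace Summit.NavierStokesRegularity.NavierStokesRegularity.Theorems.DepletionLadder.StrainCube

-- the problem directory repeats the summit name (`NavierStokesRegularity/NavierStokesRegularity`)
set_option linter.dupNamespace false

open Summit.NavierStokesRegularity.NavierStokesRegularity.Theorems.OddMorawetz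

/-! ### Schwartz fields are admissible for the depletion inequality -/

/-- Every derivative of a Schwartz map on `ℝ³` is square integrable:
`∫ ‖Dⁿf‖² < ∞` (decay `(1+|x|)² ‖Dⁿ f(x)‖ ≤ C` and `(1+|x|)⁻⁴ ∈ L¹(ℝ³)`). [folklore] -/
theorem lintegral_iteratedFDeriv_sq_lt_top_of_schwartz {F : Type*} [NormedAddCommGroup F]
    [NormedSpace ℝ F] (f : 𝓢(E3, F)) (n : ℕ) :
    ∫⁻ x, ‖iteratedFDeriv ℝ n f x‖ₑ ^ 2 < ⊤ := by
  set C : ℝ := 2 ^ (2, n).1 *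
    (Finset.Iic (2, n)).sup (fun m => SchwartzMap.seminorm ℝ m.1 m.2) f with hC
  have hdec : ∀ x : E3, (1 + ‖x‖) ^ 2 * ‖iteratedFDeriv ℝ n f x‖ ≤ C := fun x =>
    SchwartzMap.one_add_le_sup_seminorm_apply (𝕜 := ℝ) (m := (2, n)) le_rfl le_rfl f x
  have hC0 : 0 ≤ C := le_trans (by positivity) (hdec 0)
  have hpt : ∀ x : E3, ‖iteratedFDeriv ℝ n f x‖ ^ 2 ≤ C ^ 2 * (1 + ‖x‖) ^ (-(4 : ℝ)) := by
    intro x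
    have h1 : 0 < 1 + ‖x‖ := by positivity
    have h2 : ‖iteratedFDeriv ℝ n f x‖ ≤ C / (1 + ‖x‖) ^ 2 := by
      rw [le_div_iff₀ (by positivity)]; linarith [hdec x, mul_comm ((1 + ‖x‖) ^ 2) ‖iteratedFDeriv ℝ n f x‖]
    have h3 : (1 + ‖x‖) ^ (-(4 : ℝ)) = ((1 + ‖x‖) ^ 2)⁻¹ ^ 2 := by
      rw [Real.rpow_neg h1.le, show (4 : ℝ) = ((4 : ℕ) : ℝ) by norm_num, Real.rpow_natCast,
        ← inv_pow, ← inv_pow, ← pow_mul]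
    rw [h3, ← mul_pow]
    have h4 : 0 ≤ ‖iteratedFDeriv ℝ n f x‖ := norm_nonneg _
    have h5 : C / (1 + ‖x‖) ^ 2 = C * ((1 + ‖x‖) ^ 2)⁻¹ := div_eq_mul_inv _ _
    rw [h5] at h2
    exact pow_le_pow_left₀ h4 h2 2
  have hint : Integrable (fun x : E3 => C ^ 2 * (1 + ‖x‖) ^ (-(4 : ℝ))) :=
    (integrable_one_add_norm (by rw [finrank_euclideanSpace_fin]; norm_num)).const_mul _
  calc ∫⁻ x, ‖iteratedFDeriv ℝ n f x‖ₑ ^ 2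
      = ∫⁻ x, ENNReal.ofReal (‖iteratedFDeriv ℝ n f x‖ ^ 2) := by
        refine lintegral_congr fun x => ?_
        rw [← ofReal_norm, ENNReal.ofReal_pow (norm_nonneg _)]
    _ ≤ ∫⁻ x, ENNReal.ofReal (C ^ 2 * (1 + ‖x‖) ^ (-(4 : ℝ))) :=
        lintegral_mono fun x => ENNReal.ofReal_le_ofReal (hpt x)
    _ < ⊤ := hint.lintegral_lt_top

/-- A Schwartz map has bounded derivative. [folklore] -/
theorem exists_norm_fderiv_le_of_schwartz {F : Type*} [NormedAddCommGroup F] [NormedSpace ℝ F]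
    (f : 𝓢(E3, F)) : ∃ B : ℝ, ∀ x, ‖fderiv ℝ f x‖ ≤ B := by
  obtain ⟨C, -, hC⟩ := f.decay 0 1
  refine ⟨C, fun x => ?_⟩
  have h := hC x
  rw [pow_zero, one_mul, ← norm_iteratedFDeriv_fderiv, norm_iteratedFDeriv_zero] at h
  exact h

/-- **Polynomial-Gaussian fields are admissible**: `v = P e^{-|x|²}` is `C^∞` with bounded gradient
and `D⁰v, D¹v, D²v ∈ L²` (the hypothesis class of `abs_integral_stretching_le_strainCube_sharp`,
except the sup bound and the divergence). [folklore] -/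
theorem pgv_admissible (P : Fin 3 → P3) :
    ContDiff ℝ ∞ (pgv 1 P) ∧ (∃ B : ℝ, ∀ x, ‖fderiv ℝ (pgv 1 P) x‖ ≤ B) ∧
      (∫⁻ x, ‖iteratedFDeriv ℝ 0 (pgv 1 P) x‖ₑ ^ 2 < ⊤) ∧
      (∫⁻ x, ‖iteratedFDeriv ℝ 1 (pgv 1 P) x‖ₑ ^ 2 < ⊤) ∧
      (∫⁻ x, ‖iteratedFDeriv ℝ 2 (pgv 1 P) x‖ₑ ^ 2 < ⊤) := by
  rw [← coe_pgvS 1 one_pos P]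
  exact ⟨(pgvS 1 P).smooth ⊤, exists_norm_fderiv_le_of_schwartz _,
    lintegral_iteratedFDeriv_sq_lt_top_of_schwartz _ 0,
    lintegral_iteratedFDeriv_sq_lt_top_of_schwartz _ 1,
    lintegral_iteratedFDeriv_sq_lt_top_of_schwartz _ 2⟩

/-! ### The three integrands of the depletion inequality for `v = P e^{-|x|²}` -/

/-- The stretching density of `v = P e^{-|x|²}` is the polynomial Gaussian
`(Σᵢⱼ cᵢ cⱼ Dⱼ Pᵢ) e^{-3|x|²}`, `c = curlP 1 P`, `Dⱼ = ∂ⱼ − 2xⱼ`. [folklore] -/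
theorem stretching_density_pgv (P : Fin 3 → P3) (x : E3) :
    ⟪curl (pgv 1 P) x, fderiv ℝ (pgv 1 P) x (curl (pgv 1 P) x)⟫ =
      pg 3 (∑ i, ∑ j, curlP 1 P i * curlP 1 P j * dg 1 j (P i)) x := by
  rw [inner_eq_sum_mul, pg_sum]
  refine Finset.sum_congr rfl fun i _ => ?_
  rw [fderiv_pgv_apply, pg_sum, Finset.mul_sum]
  refine Finset.sum_congr rfl fun j _ => ?_
  rw [curl_pgv, pgv_apply, pgv_apply, pg_mul, pg_mul, ← mul_assoc]

/-- The enstrophy density of `v = P e^{-|x|²}`: `‖curl v‖² = (Σᵢ cᵢ²) e^{-2|x|²}`. [folklore] -/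
theorem curl_normSq_pgv (P : Fin 3 → P3) (x : E3) :
    ‖curl (pgv 1 P) x‖ ^ 2 = pg 2 (∑ i, curlP 1 P i ^ 2) x := by
  rw [EuclideanSpace.norm_sq_eq, pg_sum]
  refine Finset.sum_congr rfl fun i _ => ?_
  rw [Real.norm_eq_abs, sq_abs, curl_pgv, pgv_apply, sq, sq, pg_mul]

/-- The palinstrophy density of `v = P e^{-|x|²}`: `|∇ curl v|²_F = (Σⱼ Σᵢ (Dⱼ cᵢ)²) e^{-2|x|²}`. [folklore] -/
theorem frobeniusNormSq_fderiv_curl_pgv (P : Fin 3 → P3) (x : E3) :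
    frobeniusNormSq (fderiv ℝ (curl (pgv 1 P)) x) =
      pg 2 (∑ j, ∑ i, dg 1 j (curlP 1 P i) ^ 2) x := by
  have hc : curl (pgv 1 P) = pgv 1 (curlP 1 P) := funext (curl_pgv 1 P)
  rw [hc, frobeniusNormSq_eq_sum_sq_coord, pg_sum]
  refine Finset.sum_congr rfl fun j _ => ?_
  rw [pg_sum]
  refine Finset.sum_congr rfl fun i _ => ?_
  rw [show EuclideanSpace.basisFun (Fin 3) ℝ j = EuclideanSpace.single j (1 : ℝ) from by simp,
    fderiv_pgv_single, sq, sq, pg_mul]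

/-! ### Exact Gaussian moments at rates `2` and `3` -/

open Real in
/-- `∫ x₀^{2a} x₁^{2b} x₂^{2c} e^{-2|x|²} dx = (2a−1)‼(2b−1)‼(2c−1)‼ · (π/2)√(π/2) / 4^{a+b+c}`. [folklore] -/
theorem integral_monomial_gauss_two_even (a b c : ℕ) :
    ∫ x : E3, x 0 ^ (2 * a) * x 1 ^ (2 * b) * x 2 ^ (2 * c) * Real.exp (-2 * ‖x‖ ^ 2) =
      ((2 * a - 1).doubleFactorial * (2 * b - 1).doubleFactorial * (2 * c - 1).doubleFactorial : ℝ) *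
        ((π / 2) * Real.sqrt (π / 2) / 4 ^ (a + b + c)) := by
  rw [integral_monomial_gauss, integral_pow_even_mul_exp_neg_mul_sq (by norm_num : (0:ℝ) < 2),
    integral_pow_even_mul_exp_neg_mul_sq (by norm_num : (0:ℝ) < 2),
    integral_pow_even_mul_exp_neg_mul_sq (by norm_num : (0:ℝ) < 2)]
  have hs : Real.sqrt (π / 2) ^ 2 = π / 2 := Real.sq_sqrt (by positivity)
  rw [show (2 : ℝ) * 2 = 4 by norm_num, pow_add, pow_add]
  field_simp
  rw [hs]
  ring

open Real in
/-- `∫ x₀^{2a} x₁^{2b} x₂^{2c} e^{-3|x|²} dx = (2a−1)‼(2b−1)‼(2c−1)‼ · (π/3)√(π/3) / 6^{a+b+c}`. [folklore] -/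
theorem integral_monomial_gauss_three_even (a b c : ℕ) :
    ∫ x : E3, x 0 ^ (2 * a) * x 1 ^ (2 * b) * x 2 ^ (2 * c) * Real.exp (-3 * ‖x‖ ^ 2) =
      ((2 * a - 1).doubleFactorial * (2 * b - 1).doubleFactorial * (2 * c - 1).doubleFactorial : ℝ) *
        ((π / 3) * Real.sqrt (π / 3) / 6 ^ (a + b + c)) := by
  rw [integral_monomial_gauss, integral_pow_even_mul_exp_neg_mul_sq (by norm_num : (0:ℝ) < 3),
    integral_pow_even_mul_exp_neg_mul_sq (by norm_num : (0:ℝ) < 3),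
    integral_pow_even_mul_exp_neg_mul_sq (by norm_num : (0:ℝ) < 3)]
  have hs : Real.sqrt (π / 3) ^ 2 = π / 3 := Real.sq_sqrt (by positivity)
  rw [show (2 : ℝ) * 3 = 6 by norm_num, pow_add, pow_add]
  field_simp
  rw [hs]
  ring

/-- **The integral of a rate-`2` polynomial Gaussian with even polynomial** (list bookkeeping). [folklore] -/
theorem integral_pg_two_of_polyE (Q : P3) (L : List (ℝ × ℕ × ℕ × ℕ)) (hQ : ∀ x, pev Q x = polyE L x) :
    ∫ x, pg 2 Q x = (L.map fun t => t.1 *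
      (((2 * t.2.1 - 1).doubleFactorial * (2 * t.2.2.1 - 1).doubleFactorial *
          (2 * t.2.2.2 - 1).doubleFactorial : ℝ) *
        ((Real.pi / 2) * Real.sqrt (Real.pi / 2) / 4 ^ (t.2.1 + t.2.2.1 + t.2.2.2)))).sum := by
  have h1 : (fun x => pg 2 Q x) = fun x => polyE L x * Real.exp (-2 * ‖x‖ ^ 2) := by
    funext x; rw [pg_def, hQ x]; norm_num
  rw [h1, integral_polyE_mul _ (fun a b c => integrable_monomial_gauss (by norm_num) _ _ _)]
  congr 1
  refine List.map_congr_left fun t _ => ?_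
  rw [integral_monomial_gauss_two_even]

/-- **The integral of a rate-`3` polynomial Gaussian with even polynomial** (list bookkeeping). [folklore] -/
theorem integral_pg_three_of_polyE (Q : P3) (L : List (ℝ × ℕ × ℕ × ℕ)) (hQ : ∀ x, pev Q x = polyE L x) :
    ∫ x, pg 3 Q x = (L.map fun t => t.1 *
      (((2 * t.2.1 - 1).doubleFactorial * (2 * t.2.2.1 - 1).doubleFactorial *
          (2 * t.2.2.2 - 1).doubleFactorial : ℝ) *
        ((Real.pi / 3) * Real.sqrt (Real.pi / 3) / 6 ^ (t.2.1 + t.2.2.1 + t.2.2.2)))).sum := by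
  have h1 : (fun x => pg 3 Q x) = fun x => polyE L x * Real.exp (-3 * ‖x‖ ^ 2) := by
    funext x; rw [pg_def, hQ x]; norm_num
  rw [h1, integral_polyE_mul _ (fun a b c => integrable_monomial_gauss (by norm_num) _ _ _)]
  congr 1
  refine List.map_congr_left fun t _ => ?_
  rw [integral_monomial_gauss_three_even]



/-- Fourth-order Taylor lower bound of the exponential on `[0, ∞)`. [folklore] -/
theorem exp_ge_taylor_four {t : ℝ} (ht : 0 ≤ t) :
    1 + t + t ^ 2 / 2 + t ^ 3 / 6 + t ^ 4 / 24 ≤ Real.exp t := by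
  have h := Real.sum_le_exp_of_nonneg ht 5
  have hs : ∑ i ∈ Finset.range 5, t ^ i / (Nat.factorial i : ℝ) =
      1 + t + t ^ 2 / 2 + t ^ 3 / 6 + t ^ 4 / 24 := by
    simp only [Finset.sum_range_succ, Finset.sum_range_zero, Nat.factorial_succ, Nat.factorial_zero]
    norm_num
  rw [hs] at h
  exact h

end Summit.NavierStokesRegularity.NavierStokesRegularity.Theorems.DepletionLadder.StrainCube

end
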